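import Mathlib
import Summits.ResolutionOfSingularities.ResolutionOfSingularities.Theorems.WeightedInvariantIotaOrderPolynomialFibre
import HarnessLib

/-!
# The e.f.t. local weighted game (door `HypersurfaceCentreConstruction`): the order of a face form off the vertex

Topic: `Summits/ResolutionOfSingularities/ResolutionOfSingularities/Theorems`. Helper for the door item
`HypersurfaceCentreConstruction` (statement `stmt-ResolutionOfSingularities-19897`, route `WeightedInvariant`),
line `local-engine` of `res-L1-w43-plan-1` (L W4.3), ORDER (o13) «the `dim S = 2` rung of H2a′» held by
res-type-098: kernel **K4 «face / tangent-cone order over a FIELD»** of the design memo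
`L/res-type-098-w43/EFT-DIM2-DESIGN.md` (sha16 `57346d14bde74e12`, §2 cases B and D, §4 row K4), SPEC of res-type-098
STATUS 2026-08-27T06:43:55Z, second hand res-type-078.

[OURS · L1 W4.3] Replaces the role of NO printed item; NOT a statement of the manuscript
[claim: Hironaka2017, status: under-review]. AI work, weaker than expert review.

## Statements (pure algebra in `κ[X₀, X₁] = MvPolynomial (Fin 2) κ`, `κ` ANY field — imperfect allowed)

For `P ∈ κ[s]` with `natDegree P ≤ ν` (`1 ≤ ν`) let `Φ = Σ_{k ≤ ν} P_k · X_i^{b(ν-k)} · X_j^k` be its `(1, b)`-weighted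
homogenisation on the axes `(i, j)` (`{i, j} = {0, 1}`), and suppose `P` is NOT `c·(s - λ)^ν` (`c, λ ∈ κ`).

* `algebraMap_face_notMem_pow_of_notMem` (core, chart `X_i ≠ 0`): at every prime `𝔫` of `κ[X₀,X₁]` with `X_i ∉ 𝔫`,
  `Φ ∉ 𝔪_𝔫^ν` in the local ring `κ[X₀,X₁]_𝔫`, i.e. `ord_𝔫 Φ < ν`.
* `face_notMem_of_mem` (chart `X_i ∈ 𝔫 ∌ X_j`, needs `P_ν ≠ 0`, `b ≥ 1`): `Φ ∉ 𝔫` (a unit locally).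
* `algebraMap_face_notMem_pow` = **K4a** (case D, weights `(1,b)`): for every prime `𝔫 ⊉ (X₀, X₁)` (off the vertex),
  `Φ ∉ 𝔪_𝔫^ν`.
* `algebraMap_notMem_pow_of_isHomogeneous` = **K4b** (case B, the tangent cone): a form `F` of degree `ν` which is not
  `c·(αX₀ + βX₁)^ν` has `F ∉ 𝔪_𝔫^ν` at every prime off the vertex (in particular the INSEPARABLE cone
  `(X₁^{p^e} - μ X₀^{p^e})^m`, `μ ∉ κ^p`, has order `m < ν` everywhere off the vertex).

## Proof of the core (memo §2 B/D, through res-type-073's fibre lemma; no localisation isomorphism is built)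

Let `L = κ[X₀,X₁]_𝔫`, `x_i` the (unit) image of `X_i`, `σ₀ : κ[s] → L`, `s ↦ x_j x_i^{-b}`, `𝔭 = σ₀⁻¹ 𝔪_L` (a prime of
the PID `κ[s]`), `S = κ[s]_𝔭` (a DVR or a field), `σ : S → L` the induced LOCAL map, `ψ : S[T] → L`, `T ↦ x_i`, and
`θ : κ[X₀,X₁] → S[T]`, `X_i ↦ T`, `X_j ↦ s T^b`; then `ψ ∘ θ` is the localisation map, `θ(Φ) = T^{bν} · P`, and
`𝔮 = ψ⁻¹ 𝔪_L` has `𝔮 ∩ S = 𝔪_S`.  If `Φ ∈ 𝔪_L^ν` then `G Φ ∈ 𝔫^ν` for some `G ∉ 𝔫`, so `u · P ∈ 𝔮^ν` with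
`u = θ(G) T^{bν} ∉ 𝔮`, and res-type-073's `mem_maximalIdeal_pow_of_mul_C_mem_pow` (p501481) gives `P ∈ 𝔪_S^ν`.  Writing
`𝔭 = (π)`, `P = π^m Q` with `π ∤ Q` this says `ν ≤ m`, while `m · deg π ≤ deg P ≤ ν`: so `deg π = 1`, `Q` is a constant and
`P = c (s - λ)^ν` — excluded (`𝔭 = 0` would force `P = 0`).

## References

* J. Włodarczyk, *Functorial resolution by torus actions*, arXiv:2203.03090, §2.3.9 (charts of the weighted blow-up).
  [Wlodarczyk2022]
* M. Nagata, *Local Rings* (1962), §18 (the local rings `S(x)` of `𝔸¹_S`). [folklore]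
-/

noncomputable section

open IsLocalRing Polynomial

set_option linter.dupNamespace false -- mandated namespace of this single-conjunct summit

namespace Summit.ResolutionOfSingularities.ResolutionOfSingularities.Theorems

namespace LocalGameEFTFace

open Summit.ResolutionOfSingularities.ResolutionOfSingularities.Cruxes.HypersurfaceCentreConstruction.LocalEngine
  (mem_maximalIdeal_pow_of_mul_C_mem_pow)

universe u

variable {κ : Type u} [Field κ]

/-- In `Fin 2`, an index different from `i` is the other index `j`. [folklore] -/
theorem fin_two_eq_of_ne {i j k : Fin 2} (hij : i ≠ j) (hki : k ≠ i) : k = j := by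
  fin_cases i <;> fin_cases j <;> fin_cases k <;> simp_all

/-! ### The PID step: `P ∈ 𝔪_S^ν` in `S = κ[s]_𝔭` forces `P = c (s - λ)^ν` -/

/-- If `P ≠ c (s-λ)^ν` for all `c, λ`, `natDegree P ≤ ν`, `1 ≤ ν`, and `𝔭` is a prime of `κ[s]`, then the image of `P` in
`κ[s]_𝔭` does not lie in the `ν`-th power of the maximal ideal. [folklore] -/
theorem algebraMap_notMem_pow_atPrime {ν : ℕ} (hν : 1 ≤ ν) {P : κ[X]} (hdeg : P.natDegree ≤ ν)
    (hP : ¬ ∃ c l : κ, P = C c * (X - C l) ^ ν) (𝔭 : Ideal κ[X]) [𝔭.IsPrime] :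
    algebraMap κ[X] (Localization.AtPrime 𝔭) P ∉ maximalIdeal (Localization.AtPrime 𝔭) ^ ν := by
  classical
  set S := Localization.AtPrime 𝔭
  have hP0 : P ≠ 0 := by
    rintro rfl
    exact hP ⟨0, 0, by simp⟩
  have hinj : Function.Injective (algebraMap κ[X] S) :=
    IsLocalization.injective S 𝔭.primeCompl_le_nonZeroDivisors
  intro hmem
  by_cases h𝔭 : 𝔭 = ⊥
  · -- `S` is the fraction field: `𝔪_S = 0`
    have hmax : maximalIdeal S = ⊥ := by
      rw [← Localization.AtPrime.map_eq_maximalIdeal, Ideal.map_eq_bot_iff_le_ker]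
      intro x hx
      have hx0 : x = 0 := by simpa [h𝔭] using hx
      simp [hx0]
    rw [hmax, ← Ideal.zero_eq_bot, zero_pow (by omega), Ideal.zero_eq_bot, Ideal.mem_bot,
      map_eq_zero_iff _ hinj] at hmem
    exact hP0 hmem
  · -- `𝔭 = (π)` with `π` prime; `P = π^m Q`, `π ∤ Q`
    set π := Submodule.IsPrincipal.generator 𝔭 with hπdef
    have hπ : Prime π := Submodule.IsPrincipal.prime_generator_of_isPrime 𝔭 h𝔭
    have h𝔭π : 𝔭 = Ideal.span {π} := (Ideal.span_singleton_generator 𝔭).symm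
    obtain ⟨Q, hPQ, hQ⟩ := (FiniteMultiplicity.of_prime_left hπ hP0).exists_eq_pow_mul_and_not_dvd
    set m := multiplicity π P with hm
    have hQ𝔭 : Q ∉ 𝔭 := by rwa [h𝔭π, Ideal.mem_span_singleton]
    have hQunit : IsUnit (algebraMap κ[X] S Q) := IsLocalization.map_units (M := 𝔭.primeCompl) S ⟨Q, hQ𝔭⟩
    have hmaxS : maximalIdeal S = Ideal.span {algebraMap κ[X] S π} := by
      rw [← Localization.AtPrime.map_eq_maximalIdeal]
      have h1 := congrArg (Ideal.map (algebraMap κ[X] S)) h𝔭π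
      rw [h1, Ideal.map_span, Set.image_singleton]
    -- `π^ν ∣ π^m` in `S`
    have hπS0 : algebraMap κ[X] S π ≠ 0 := fun h => hπ.ne_zero (hinj (by rw [h, map_zero]))
    have hπSnu : ¬ IsUnit (algebraMap κ[X] S π) := fun h =>
      (IsLocalRing.maximalIdeal.isMaximal S).ne_top
        (Ideal.eq_top_of_isUnit_mem _ (hmaxS ▸ Ideal.mem_span_singleton_self _) h)
    have hνm : ν ≤ m := by
      rw [hmaxS, Ideal.span_singleton_pow, Ideal.mem_span_singleton, hPQ, map_mul, map_pow,
        hQunit.dvd_mul_right, pow_dvd_pow_iff hπS0 hπSnu] at hmem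
      exact hmem
    -- degrees: `m · deg π + deg Q = deg P ≤ ν ≤ m`
    have hQ0 : Q ≠ 0 := by
      rintro rfl
      exact hP0 (by rw [hPQ, mul_zero])
    have hdegπ : 1 ≤ π.natDegree :=
      Polynomial.natDegree_pos_iff_degree_pos.mpr (Polynomial.degree_pos_of_irreducible hπ.irreducible)
    have hdegsum : P.natDegree = m * π.natDegree + Q.natDegree := by
      rw [hPQ, Polynomial.natDegree_mul (pow_ne_zero _ hπ.ne_zero) hQ0, Polynomial.natDegree_pow]
    have hm1 : 1 ≤ m := hν.trans hνm
    have hdegπ' : π.natDegree ≤ 1 := by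
      by_contra h
      have : m * 2 ≤ m * π.natDegree := Nat.mul_le_mul_left m (by omega)
      omega
    have hdegπ1 : π.natDegree = 1 := le_antisymm hdegπ' hdegπ
    have hdegQ : Q.natDegree = 0 := by
      rw [hdegπ1] at hdegsum
      omega
    have hmν : m = ν := by
      rw [hdegπ1] at hdegsum
      omega
    -- `π = a (s - λ)`, `Q = q`
    obtain ⟨q, hq⟩ : ∃ q, Q = C q := ⟨Q.coeff 0, Polynomial.eq_C_of_natDegree_eq_zero hdegQ⟩
    set a := π.coeff 1 with ha
    set a₀ := π.coeff 0 with ha₀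
    have ha0 : a ≠ 0 := by
      have h := π.leadingCoeff_ne_zero.mpr hπ.ne_zero
      rwa [Polynomial.leadingCoeff, hdegπ1] at h
    have hπlin : π = C a * (X - C (-(a₀ * a⁻¹))) := by
      conv_lhs => rw [Polynomial.eq_X_add_C_of_natDegree_le_one hdegπ']
      rw [map_neg, sub_neg_eq_add, mul_add, ← map_mul, mul_comm a (a₀ * a⁻¹), inv_mul_cancel_right₀ ha0]
    apply hP
    refine ⟨a ^ ν * q, -(a₀ * a⁻¹), ?_⟩
    rw [hPQ, hq, hmν, hπlin, mul_pow, ← map_pow, map_mul]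
    ring

/-! ### The vertex chart: `X_i ∈ 𝔫`, `X_j ∉ 𝔫` -/

/-- On the chart `X_i ∈ 𝔫 ∌ X_j` (so `𝔫` is off the vertex), the face form `Φ ≡ P_ν X_j^ν (mod X_i)` with `P_ν ≠ 0`
lies outside `𝔫` (`b ≥ 1`). [folklore] -/
theorem face_notMem_of_mem {i j : Fin 2} {b ν : ℕ} (hb : 1 ≤ b) {P : κ[X]} (hPν : P.coeff ν ≠ 0)
    {Φ : MvPolynomial (Fin 2) κ}
    (hΦ : Φ = ∑ k ∈ Finset.range (ν + 1),
      MvPolynomial.C (P.coeff k) * MvPolynomial.X i ^ (b * (ν - k)) * MvPolynomial.X j ^ k)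
    (𝔫 : Ideal (MvPolynomial (Fin 2) κ)) [𝔫.IsPrime] (hi : MvPolynomial.X i ∈ 𝔫) (hj : MvPolynomial.X j ∉ 𝔫) :
    Φ ∉ 𝔫 := by
  classical
  intro hΦ𝔫
  -- `Φ = P_ν X_j^ν + X_i · H`
  set H : MvPolynomial (Fin 2) κ := ∑ k ∈ Finset.range ν,
    MvPolynomial.C (P.coeff k) * MvPolynomial.X i ^ (b * (ν - k) - 1) * MvPolynomial.X j ^ k with hH
  have hsplit : Φ = MvPolynomial.C (P.coeff ν) * MvPolynomial.X j ^ ν + MvPolynomial.X i * H := by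
    rw [hΦ, Finset.sum_range_succ, Nat.sub_self, mul_zero, pow_zero, mul_one, add_comm, hH, Finset.mul_sum]
    congr 1
    refine Finset.sum_congr rfl fun k hk => ?_
    have hk' : k < ν := Finset.mem_range.mp hk
    have h1 : 1 ≤ b * (ν - k) := Nat.one_le_iff_ne_zero.mpr (Nat.mul_ne_zero (by omega) (by omega))
    conv_lhs => rw [← Nat.sub_add_cancel h1, pow_succ]
    ring
  have hX : MvPolynomial.C (P.coeff ν) * MvPolynomial.X j ^ ν ∈ 𝔫 := by
    have h := Ideal.sub_mem _ hΦ𝔫 (Ideal.mul_mem_right H _ hi)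
    rwa [hsplit, add_sub_cancel_right] at h
  rcases (‹𝔫.IsPrime›).mem_or_mem hX with hC | hXj
  · exact (‹𝔫.IsPrime›).ne_top (Ideal.eq_top_of_isUnit_mem _ hC ((isUnit_iff_ne_zero.mpr hPν).map MvPolynomial.C))
  · exact hj ((‹𝔫.IsPrime›).mem_of_pow_mem ν hXj)

/-! ### The core: chart `X_i ∉ 𝔫` -/

/-- **Core of K4** (memo §2, cases B/D): on the chart `X_i ∉ 𝔫` the `(1,b)`-face form `Φ` of `P` has order `< ν` at
`𝔫`, i.e. `Φ ∉ 𝔪_𝔫^ν` in `κ[X₀,X₁]_𝔫`, unless `P = c (s - λ)^ν` (`κ` any field, `natDegree P ≤ ν`, `1 ≤ ν`; `b`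
arbitrary here). [cite: Wlodarczyk2022, §2.3.9] -/
theorem algebraMap_face_notMem_pow_of_notMem {i j : Fin 2} (hij : i ≠ j) {b ν : ℕ} (hν : 1 ≤ ν) {P : κ[X]}
    (hdeg : P.natDegree ≤ ν) (hP : ¬ ∃ c l : κ, P = C c * (X - C l) ^ ν) {Φ : MvPolynomial (Fin 2) κ}
    (hΦ : Φ = ∑ k ∈ Finset.range (ν + 1),
      MvPolynomial.C (P.coeff k) * MvPolynomial.X i ^ (b * (ν - k)) * MvPolynomial.X j ^ k)
    (𝔫 : Ideal (MvPolynomial (Fin 2) κ)) [𝔫.IsPrime] (hi : MvPolynomial.X i ∉ 𝔫) :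
    algebraMap (MvPolynomial (Fin 2) κ) (Localization.AtPrime 𝔫) Φ ∉
      maximalIdeal (Localization.AtPrime 𝔫) ^ ν := by
  classical
  intro hmem
  -- the unit `x_i`
  have hxi : IsUnit (algebraMap (MvPolynomial (Fin 2) κ) (Localization.AtPrime 𝔫) (MvPolynomial.X i)) :=
    IsLocalization.map_units (M := 𝔫.primeCompl) (Localization.AtPrime 𝔫) ⟨MvPolynomial.X i, hi⟩
  set xi : (Localization.AtPrime 𝔫)ˣ := hxi.unit with hxidef
  have hxi_coe : (xi : Localization.AtPrime 𝔫) = algebraMap (MvPolynomial (Fin 2) κ) (Localization.AtPrime 𝔫) (MvPolynomial.X i) := hxi.unit_spec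
  set xj : Localization.AtPrime 𝔫 := algebraMap (MvPolynomial (Fin 2) κ) (Localization.AtPrime 𝔫) (MvPolynomial.X j) with hxjdef
  -- `σ₀ : κ[s] → κ[X₀,X₁]_𝔫`, `s ↦ x_j x_i^{-b}`
  set σ₀ : κ[X] →+* Localization.AtPrime 𝔫 := Polynomial.eval₂RingHom ((algebraMap (MvPolynomial (Fin 2) κ) (Localization.AtPrime 𝔫)).comp MvPolynomial.C) (xj * ↑(xi⁻¹) ^ b)
    with hσ₀
  set 𝔭 : Ideal κ[X] := (maximalIdeal (Localization.AtPrime 𝔫)).comap σ₀ with h𝔭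
  haveI h𝔭prime : 𝔭.IsPrime := Ideal.comap_isPrime σ₀ _
  set S := Localization.AtPrime 𝔭 with hS
  have hunits : ∀ y : 𝔭.primeCompl, IsUnit (σ₀ y) := fun y => by
    by_contra hnu
    exact y.2 (Ideal.mem_comap.mpr ((IsLocalRing.mem_maximalIdeal _).mpr hnu))
  set σ : S →+* Localization.AtPrime 𝔫 := IsLocalization.lift (M := 𝔭.primeCompl) hunits with hσ
  have hσ_alg : ∀ q : κ[X], σ (algebraMap κ[X] S q) = σ₀ q := fun q => IsLocalization.lift_eq hunits q
  -- `ψ : S[T] → κ[X₀,X₁]_𝔫`, `T ↦ x_i`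
  set ψ : S[X] →+* Localization.AtPrime 𝔫 := Polynomial.eval₂RingHom σ (xi : Localization.AtPrime 𝔫) with hψ
  -- `θ : κ[X₀,X₁] → S[T]`, `X_i ↦ T`, `X_j ↦ s T^b`
  set sS : S := algebraMap κ[X] S X with hsS
  set g : Fin 2 → S[X] := fun k => if k = i then X else Polynomial.C sS * X ^ b with hg
  set θ : MvPolynomial (Fin 2) κ →+* S[X] := MvPolynomial.eval₂Hom (Polynomial.C.comp ((algebraMap κ[X] S).comp Polynomial.C)) g
    with hθ
  have hσ₀C : ∀ c : κ, σ₀ (Polynomial.C c) = algebraMap (MvPolynomial (Fin 2) κ) (Localization.AtPrime 𝔫) (MvPolynomial.C c) := fun c => by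
    rw [hσ₀, Polynomial.coe_eval₂RingHom, Polynomial.eval₂_C, RingHom.comp_apply]
  have hσ₀X : σ₀ X = xj * ↑(xi⁻¹) ^ b := by
    rw [hσ₀, Polynomial.coe_eval₂RingHom, Polynomial.eval₂_X]
  have hψC : ∀ q : S, ψ (Polynomial.C q) = σ q := fun q => by
    rw [hψ, Polynomial.coe_eval₂RingHom, Polynomial.eval₂_C]
  have hψX : ψ X = (xi : Localization.AtPrime 𝔫) := by
    rw [hψ, Polynomial.coe_eval₂RingHom, Polynomial.eval₂_X]
  have hθC : ∀ c : κ, θ (MvPolynomial.C c) = Polynomial.C (algebraMap κ[X] S (Polynomial.C c)) := fun c => by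
    rw [hθ, MvPolynomial.eval₂Hom_C, RingHom.comp_apply, RingHom.comp_apply]
  have hθXi : θ (MvPolynomial.X i) = X := by
    rw [hθ, MvPolynomial.eval₂Hom_X', hg]
    simp
  have hθXj : θ (MvPolynomial.X j) = Polynomial.C sS * X ^ b := by
    rw [hθ, MvPolynomial.eval₂Hom_X', hg]
    simp [hij.symm]
  -- `ψ ∘ θ = algebraMap`
  have hψθ : ψ.comp θ = algebraMap (MvPolynomial (Fin 2) κ) (Localization.AtPrime 𝔫) := by
    refine MvPolynomial.ringHom_ext (fun c => ?_) (fun k => ?_)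
    · rw [RingHom.comp_apply, hθC, hψC, hσ_alg, hσ₀C]
    · rw [RingHom.comp_apply]
      by_cases hk : k = i
      · rw [hk, hθXi, hψX, hxi_coe]
      · rw [fin_two_eq_of_ne hij hk, hθXj, map_mul, map_pow, hψC, hψX, hsS, hσ_alg, hσ₀X, mul_assoc,
          ← mul_pow, Units.inv_mul, one_pow, mul_one]
  have hψθ' : ∀ f : MvPolynomial (Fin 2) κ, ψ (θ f) = algebraMap (MvPolynomial (Fin 2) κ) (Localization.AtPrime 𝔫) f := fun f => by rw [← RingHom.comp_apply, hψθ]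
  -- `θ Φ = T^{bν} · P`
  have hθΦ : θ Φ = X ^ (b * ν) * Polynomial.C (algebraMap κ[X] S P) := by
    have hPsum : P = ∑ k ∈ Finset.range (ν + 1), Polynomial.C (P.coeff k) * X ^ k := by
      conv_lhs => rw [P.as_sum_range' (ν + 1) (Nat.lt_succ_of_le hdeg)]
      simp only [Polynomial.C_mul_X_pow_eq_monomial]
    rw [hΦ, map_sum]
    conv_rhs => rw [hPsum, map_sum, map_sum, Finset.mul_sum]
    refine Finset.sum_congr rfl fun k hk => ?_
    have hk' : k ≤ ν := Nat.lt_succ_iff.mp (Finset.mem_range.mp hk)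
    simp only [map_mul, map_pow, hθC, hθXi, hθXj]
    rw [← hsS, mul_pow, ← pow_mul]
    have : b * (ν - k) + b * k = b * ν := by rw [← Nat.mul_add, Nat.sub_add_cancel hk']
    rw [← this, pow_add]
    ring
  -- `𝔮 = ψ⁻¹ 𝔪_L`, `𝔮 ∩ S = 𝔪_S`
  set 𝔮 : Ideal S[X] := (maximalIdeal (Localization.AtPrime 𝔫)).comap ψ with h𝔮def
  haveI : 𝔮.IsPrime := Ideal.comap_isPrime ψ _
  have h𝔮 : 𝔮.comap (Polynomial.C : S →+* S[X]) = maximalIdeal S := by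
    have hcomp : 𝔮.comap (Polynomial.C : S →+* S[X]) = (maximalIdeal (Localization.AtPrime 𝔫)).comap σ := by
      rw [h𝔮def, Ideal.comap_comap]
      congr 1
      exact RingHom.ext fun q => by rw [RingHom.comp_apply, hψC]
    rw [hcomp]
    have hne : (maximalIdeal (Localization.AtPrime 𝔫)).comap σ ≠ ⊤ := (Ideal.comap_isPrime σ (maximalIdeal (Localization.AtPrime 𝔫))).ne_top
    have hle : maximalIdeal S ≤ (maximalIdeal (Localization.AtPrime 𝔫)).comap σ := by
      rw [← Localization.AtPrime.map_eq_maximalIdeal, Ideal.map_le_iff_le_comap, Ideal.comap_comap,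
        IsLocalization.lift_comp]
    exact ((IsLocalRing.maximalIdeal.isMaximal S).eq_of_le hne hle).symm
  -- `θ 𝔫 ⊆ 𝔮`
  have hθ𝔫 : 𝔫.map θ ≤ 𝔮 := by
    rw [Ideal.map_le_iff_le_comap]
    intro n hn
    rw [Ideal.mem_comap, h𝔮def, Ideal.mem_comap, hψθ']
    exact (IsLocalization.AtPrime.to_map_mem_maximal_iff (Localization.AtPrime 𝔫) 𝔫 n).mpr hn
  -- `G Φ ∈ 𝔫^ν` with `G ∉ 𝔫`
  rw [← Localization.AtPrime.map_eq_maximalIdeal, ← Ideal.map_pow,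
    IsLocalization.algebraMap_mem_map_algebraMap_iff 𝔫.primeCompl] at hmem
  obtain ⟨G, hG, hGΦ⟩ := hmem
  have hG' : G ∉ 𝔫 := hG
  -- `u = θ G · T^{bν} ∉ 𝔮` and `u · P ∈ 𝔮^ν`
  have hu : θ G * X ^ (b * ν) ∉ 𝔮 := by
    intro h
    rcases (‹𝔮.IsPrime›).mem_or_mem h with h1 | h2
    · rw [h𝔮def, Ideal.mem_comap, hψθ'] at h1
      exact hG' ((IsLocalization.AtPrime.to_map_mem_maximal_iff (Localization.AtPrime 𝔫) 𝔫 G).mp h1)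
    · have hX𝔮 := (‹𝔮.IsPrime›).mem_of_pow_mem _ h2
      rw [h𝔮def, Ideal.mem_comap, hψX] at hX𝔮
      exact (IsLocalRing.mem_maximalIdeal _).mp hX𝔮 xi.isUnit
  have huP : θ G * X ^ (b * ν) * Polynomial.C (algebraMap κ[X] S P) ∈ 𝔮 ^ ν := by
    rw [mul_assoc, ← hθΦ, ← map_mul]
    exact Ideal.pow_right_mono hθ𝔫 ν (by rw [← Ideal.map_pow]; exact Ideal.mem_map_of_mem θ hGΦ)
  -- res-type-073's fibre lemma, then the PID step
  exact algebraMap_notMem_pow_atPrime hν hdeg hP 𝔭 (mem_maximalIdeal_pow_of_mul_C_mem_pow 𝔮 h𝔮 hu huP)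

/-! ### K4a: case D (weights `(1, b)`) -/

/-- **K4a (res-type-098 EFT-DIM2-DESIGN §2, case D)**: let `κ` be any field, `1 ≤ b`, `1 ≤ ν`, `P ∈ κ[s]` with
`natDegree P ≤ ν`, `P_ν ≠ 0`, and NOT of the form `c (s - λ)^ν`; let `Φ = Σ_{k ≤ ν} P_k X₀^{b(ν-k)} X₁^k` be its
`(1,b)`-homogenisation.  Then at every prime `𝔫` of `κ[X₀,X₁]` off the vertex (`(X₀, X₁) ⊄ 𝔫`), `Φ ∉ 𝔪_𝔫^ν` in
`κ[X₀,X₁]_𝔫`. [cite: Wlodarczyk2022, §2.3.9] -/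
theorem algebraMap_face_notMem_pow {b ν : ℕ} (hb : 1 ≤ b) (hν : 1 ≤ ν) {P : κ[X]} (hdeg : P.natDegree ≤ ν)
    (hPν : P.coeff ν ≠ 0) (hP : ¬ ∃ c l : κ, P = C c * (X - C l) ^ ν) {Φ : MvPolynomial (Fin 2) κ}
    (hΦ : Φ = ∑ k ∈ Finset.range (ν + 1),
      MvPolynomial.C (P.coeff k) * MvPolynomial.X 0 ^ (b * (ν - k)) * MvPolynomial.X 1 ^ k)
    (𝔫 : Ideal (MvPolynomial (Fin 2) κ)) [𝔫.IsPrime]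
    (hvert : ¬ Ideal.span {(MvPolynomial.X 0 : MvPolynomial (Fin 2) κ), MvPolynomial.X 1} ≤ 𝔫) :
    algebraMap (MvPolynomial (Fin 2) κ) (Localization.AtPrime 𝔫) Φ ∉
      maximalIdeal (Localization.AtPrime 𝔫) ^ ν := by
  by_cases h0 : (MvPolynomial.X 0 : MvPolynomial (Fin 2) κ) ∈ 𝔫
  · have h1 : (MvPolynomial.X 1 : MvPolynomial (Fin 2) κ) ∉ 𝔫 := fun h1 => hvert (by
      rw [Ideal.span_le, Set.insert_subset_iff, Set.singleton_subset_iff]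
      exact ⟨h0, h1⟩)
    have hΦ𝔫 : Φ ∉ 𝔫 := face_notMem_of_mem hb hPν hΦ 𝔫 h0 h1
    intro hmem
    have hunit : IsUnit (algebraMap (MvPolynomial (Fin 2) κ) (Localization.AtPrime 𝔫) Φ) :=
      IsLocalization.map_units (M := 𝔫.primeCompl) _ ⟨Φ, hΦ𝔫⟩
    exact (IsLocalRing.mem_maximalIdeal _).mp (Ideal.pow_le_self (by omega) hmem) hunit
  · exact algebraMap_face_notMem_pow_of_notMem (i := 0) (j := 1) (by decide) hν hdeg hP hΦ 𝔫 h0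

end LocalGameEFTFace

end Summit.ResolutionOfSingularities.ResolutionOfSingularities.Theorems

end
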